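import Summits.ResolutionOfSingularities.ResolutionOfSingularities.Theorems.HilbertSamuelEliminationSigmaMaxModificationsCorridor3WLadderDefs
import HarnessLib

/-!
# CHAIN w42 — W-LADDER, helpers v3.5: the PROVED REDUCTIONS (companion of the definitions module)

[OURS · L1 W4.2] Companion of `HilbertSamuelEliminationSigmaMaxModificationsCorridor3WLadderDefs.lean` (W-LADDER DEFINITIONS MODULE,
helpers v3.5 of crux planner res-L1-w42-plan-1, `L/w42/Corridor3WLadder.lean` sha16 `003346748a44856a`, landed VERBATIM by typer
res-type-053 on the planner's TYPING-WANTED 2026-08-27T03:26:02Z). The gate caps Theorems files with proofs at 400 lines, so the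
planner's single file is split: the definitions module carries every `def`/`structure`, THIS file every PROVED reduction — both
byte-identical, in the original order, same namespace `…Theorems.SigmaMaxModificationsCorridor3.Helpers` (see the definitions
module's docstring for the row table). Contents: links to `NearChainTermination(At)` (p487178); graded splits
`closedOriginNoNearChain_of_grades` / `_of_exactGrades`; dimension bookkeeping; `WA3_of_CJS` (WA PROVED modulo CJS Thm. 1.2);
`WB_of_W(_exact)`, `nuMod_three_of_WA_WB`, `confinedWildNu3_of_WA_WB`; regime joins and `WB3_of_rows`; `eq_two_of_not_qCharRegime`;
the shadow-law reduction `closedOriginNoNearChainAtQ_of_shadowLaw` and corollaries; the F-key bridge reductions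
`wlow3Char_e2_of_bridge` (CJS Thm. 6.40, `KeyTheorem640_char`), `wlow3Char_e1_of_bridgeSeq` (Cor. 6.37, `Corollary637_char`),
`wlow3Char_of_grades`. Sorry-free helper of stmt-ResolutionOfSingularities-18506; NOT a statement of any manuscript ([Hironaka2017]
is never a premise); AI-drafted/AI-landed, AI review is weaker than expert review. [CossartJannsenSaito2020, LNM 2270, pp. 103–107]
-/

set_option linter.dupNamespace false

noncomputable section

open CategoryTheory CategoryTheory.Limits AlgebraicGeometry TopologicalSpace Topology
open Literature.AlgebraicGeometry.Resolution Literature.RingTheory.HilbertSamuel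
open Summit.ResolutionOfSingularities.ResolutionOfSingularities.Theorems.SigmaMaxModificationsCorridor3.TameWild
open Summit.ResolutionOfSingularities.ResolutionOfSingularities.Theorems.CampaignW42

namespace Summit.ResolutionOfSingularities.ResolutionOfSingularities.Theorems.SigmaMaxModificationsCorridor3.Helpers

universe u


/-! ## §A. C5/C6 interface — the round lemma WITH the decrease clause -/

/-! ## §B. The W-ladder — wild core in the marked-stage language, over MAXIMAL ORIGINS (`CampaignW42.IsMaximalOrigin`:
`X` reduced, separated, of finite type over a field of characteristic `p`, `dim X ≤ N`, `ν ∈ Σ_X(N)^max`, `x` a CLOSED point of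
`X(ν)` of any shape — a confined stage has a positive-dimensional top stratum and cannot be isolated). -/

/-- The maximal-origin statement at grade `ē = e` (all levels) implies the campaign's isolated-origin
`TertiaryTerminationAt p e`. [folklore] -/
theorem tertiaryTerminationAt_of_closedOrigin {p e : ℕ}
    (h : ∀ N, ClosedOriginNoNearChainAt.{u} p N fun s => s.geomDirDim = e) :
    TertiaryTerminationAt.{u} p e := by
  intro R hRf hRa N ν X _ x hX
  exact h N R hRf hRa ν X x hX.isMaximalOrigin

/-- The maximal-origin statement with `G = ⊤` (all levels) implies the campaign's `TertiaryTermination p`. [folklore] -/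
theorem tertiaryTermination_of_closedOrigin {p : ℕ}
    (h : ∀ N, ClosedOriginNoNearChainAt.{u} p N fun _ => True) :
    TertiaryTermination.{u} p := by
  intro R hRf hRa N ν X _ x hX
  exact h N R hRf hRa ν X x hX.isMaximalOrigin

/-- LINK with s42-pv-2's all-level item: `NearChainTerminationAt p e` (p487178) is the conjunction over all levels `N` of the
grade-`e` rows. [folklore] -/
theorem nearChainTerminationAt_iff {p e : ℕ} :
    NearChainTerminationAt.{u} p e ↔ ∀ N, ClosedOriginNoNearChainAt.{u} p N fun s => s.geomDirDim = e :=
  ⟨fun h N R hRf hRa ν X _ x hX => h R hRf hRa N ν X x hX, fun h R hRf hRa N ν X _ x hX => h N R hRf hRa ν X x hX⟩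

/-- LINK: `NearChainTermination p` (hypothesis (B)_p of the calibration theorems p486973 / p487563 / p488719) is the
conjunction over all levels of the ungraded rows. [folklore] -/
theorem nearChainTermination_iff {p : ℕ} :
    NearChainTermination.{u} p ↔ ∀ N, ClosedOriginNoNearChainAt.{u} p N fun _ => True :=
  ⟨fun h N R hRf hRa ν X _ x hX => h R hRf hRa N ν X x hX, fun h R hRf hRa N ν X _ x hX => h N R hRf hRa ν X x hX⟩

/-- **THE GRADED SPLIT (PROVED)**: monotonicity of `ē` + no low-grade chain + no top-grade chain ⇒ no chain at all,
from maximal origins (the campaign's `tertiaryTermination_of_forall` pattern: `ē` is eventually constant along an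
infinite chain, and the tail lies in one of the two grades). [folklore] -/
theorem closedOriginNoNearChain_of_grades {p N : ℕ} (hmono : ClosedOriginGeomDirDimNonincrease.{u} p N)
    (hlow : ClosedOriginNoNearChainAt.{u} p N fun s => s.geomDirDim ≤ 2)
    (htop : ClosedOriginNoNearChainAt.{u} p N fun s => 3 ≤ s.geomDirDim) :
    ClosedOriginNoNearChainAt.{u} p N fun _ => True := by
  intro R hRf hRa ν X _ x hX
  rintro ⟨c, h0, hstep, -⟩
  have hsc : ∀ n, InScopeC p R N ν (c n) := fun n =>
    ⟨X, inferInstance, x, hX, reaches_chain h0 hstep n⟩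
  have hg : ∀ n, (c (n + 1)).geomDirDim ≤ (c n).geomDirDim := fun n =>
    hmono R hRf hRa ν (c n) (c (n + 1)) (hsc n) (hstep n)
  obtain ⟨n₀, hn₀⟩ := eventually_const_of_succ_le (g := fun n => (c n).geomDirDim) hg
  have htail0 : Reaches R N ν (MarkedStage.init X x) (c (n₀ + 0)) := reaches_chain h0 hstep n₀
  have htails : ∀ n, CanonicalNearStep R N ν (c (n₀ + n)) (c (n₀ + (n + 1))) := fun n => hstep (n₀ + n)
  by_cases h3 : 3 ≤ (c n₀).geomDirDim
  · exact htop R hRf hRa ν X x hX ⟨fun n => c (n₀ + n), htail0, htails, fun n => by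
      show 3 ≤ (c (n₀ + n)).geomDirDim
      rw [show (c (n₀ + n)).geomDirDim = (c n₀).geomDirDim from hn₀ n]; exact h3⟩
  · exact hlow R hRf hRa ν X x hX ⟨fun n => c (n₀ + n), htail0, htails, fun n => by
      show (c (n₀ + n)).geomDirDim ≤ 2
      rw [show (c (n₀ + n)).geomDirDim = (c n₀).geomDirDim from hn₀ n]; omega⟩

/-- **THE EXACT-GRADE SPLIT (PROVED)**: with W-mono, `ē` is eventually CONSTANT along an infinite chain, so it suffices to
exclude chains of constant grade `ē = e` for each `e ≤ 2` and chains of grade `≥ 3`. [folklore] -/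
theorem closedOriginNoNearChain_of_exactGrades {p N : ℕ} (hmono : ClosedOriginGeomDirDimNonincrease.{u} p N)
    (hlow : ∀ e ≤ 2, ClosedOriginNoNearChainAt.{u} p N fun s => s.geomDirDim = e)
    (htop : ClosedOriginNoNearChainAt.{u} p N fun s => 3 ≤ s.geomDirDim) :
    ClosedOriginNoNearChainAt.{u} p N fun _ => True := by
  refine closedOriginNoNearChain_of_grades hmono ?_ htop
  intro R hRf hRa ν X _ x hX
  rintro ⟨c, h0, hstep, hle⟩
  have hsc : ∀ n, InScopeC p R N ν (c n) := fun n =>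
    ⟨X, inferInstance, x, hX, reaches_chain h0 hstep n⟩
  have hg : ∀ n, (c (n + 1)).geomDirDim ≤ (c n).geomDirDim := fun n =>
    hmono R hRf hRa ν (c n) (c (n + 1)) (hsc n) (hstep n)
  obtain ⟨n₀, hn₀⟩ := eventually_const_of_succ_le (g := fun n => (c n).geomDirDim) hg
  exact hlow (c n₀).geomDirDim (hle n₀) R hRf hRa ν X x hX ⟨fun n => c (n₀ + n), reaches_chain h0 hstep n₀,
    fun n => hstep (n₀ + n), fun n => by
      show (c (n₀ + n)).geomDirDim = (c n₀).geomDirDim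
      exact hn₀ n⟩

/-- **Dimension bookkeeping (PROVED): a canonical near step does not raise the dimension of the stage** (blow-ups of locally
noetherian schemes, tree `IsBlowup.topologicalKrullDim_le_of_isLocallyNoetherian`). With `ē_x ≤ dim 𝒪_{X,x} ≤ dim X`
(tree `Scheme.natCast_geomDirDim_le_ringKrullDim_stalk`, `ringKrullDim_stalk_le_topologicalKrullDim`) this makes the grade-`≥ 3`
rows vacuous from origins of dimension `≤ 2`. [folklore] -/
theorem canonicalNearStep_dim_le {R : ∀ S : Scheme.{u}, CentreSeq S → Prop} {N : ℕ} {ν : ℕ → ℕ}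
    {s s' : MarkedStage.{u}} (h : CanonicalNearStep R N ν s s') {d : ℕ}
    (hd : topologicalKrullDim s.W ≤ (d : WithBot ℕ∞)) : topologicalKrullDim s'.W ≤ (d : WithBot ℕ∞) := by
  obtain ⟨C, P', h', x', -, -, -, -, rfl⟩ := h
  haveI := s.ln
  exact (blowup.isBlowup C).topologicalKrullDim_le_of_isLocallyNoetherian hd

/-- Along a chain reached from a stage of dimension `≤ d`, every stage has dimension `≤ d`. [folklore] -/
theorem chain_dim_le {R : ∀ S : Scheme.{u}, CentreSeq S → Prop} {N : ℕ} {ν : ℕ → ℕ}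
    {s₀ : MarkedStage.{u}} {c : ℕ → MarkedStage.{u}} (h0 : Reaches R N ν s₀ (c 0))
    (hstep : ∀ n, CanonicalNearStep R N ν (c n) (c (n + 1))) {d : ℕ}
    (hd : topologicalKrullDim s₀.W ≤ (d : WithBot ℕ∞)) (n : ℕ) : topologicalKrullDim (c n).W ≤ (d : WithBot ℕ∞) := by
  have hreach : ∀ {t : MarkedStage.{u}}, Reaches R N ν s₀ t → topologicalKrullDim t.W ≤ (d : WithBot ℕ∞) := by
    intro t ht
    induction ht with
    | refl => exact hd
    | tail _ hst ih => exact canonicalNearStep_dim_le hst ih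
  exact hreach (reaches_chain h0 hstep n)

/-! ## §C. The skeleton-level statements WA / WB -/

/-- **WA PROVED modulo the printed resolution of excellent surfaces** (CJS Thm. 1.2 as the named fact
`CossartJannsenSaito2020SequencePermissible`, p478780): s42-pv-2's calibration engine `nuMod_threefold_of_noNearChains`
(choice oracle; answers on the strata of dimension `≤ 2`; compactness without isolation; termination ⇒ `ν`-elimination ⇒
`NuMod`). [cite: CossartJannsenSaito2020, Thm. 1.2, Rem. 6.29 (1), Def. 6.14, p. 107] -/
theorem WA3_of_CJS (hCJS : CossartJannsenSaito2020SequencePermissible.{0}) : WA3 := by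
  intro p _ hT k _ _ Y g _ hft hqc hred hdim ν hmax hne
  haveI := hft
  haveI := hqc
  haveI := hred
  haveI : IsLocallyNoetherian Y := LocallyOfFiniteType.isLocallyNoetherian g
  exact nuMod_threefold_of_noNearChains hCJS g hdim hdim hdim hmax hne fun R hRf hRa _ y hy hyc =>
    hT R hRf hRa ν Y y ⟨⟨k, inferInstance, inferInstance, g, ‹_›, hft, hqc⟩, hred, hdim, hmax, hyc, hy⟩

/-- **WB from the graded rows (PROVED).** [folklore] -/
theorem WB_of_W (hmono : ∀ p : ℕ, p.Prime → ClosedOriginGeomDirDimNonincrease.{0} p 3)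
    (hlow : ∀ p : ℕ, p.Prime → ClosedOriginNoNearChainAt.{0} p 3 fun s => s.geomDirDim ≤ 2)
    (htop : ∀ p : ℕ, p.Prime → ClosedOriginNoNearChainAt.{0} p 3 fun s => 3 ≤ s.geomDirDim) : WB3 :=
  fun p hp => closedOriginNoNearChain_of_grades (hmono p hp) (hlow p hp) (htop p hp)

/-- **WB from the EXACT-grade rows (PROVED).** [folklore] -/
theorem WB_of_W_exact (hmono : ∀ p : ℕ, p.Prime → ClosedOriginGeomDirDimNonincrease.{0} p 3)
    (hlow : ∀ p : ℕ, p.Prime → ∀ e ≤ 2, ClosedOriginNoNearChainAt.{0} p 3 fun s => s.geomDirDim = e)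
    (htop : ∀ p : ℕ, p.Prime → ClosedOriginNoNearChainAt.{0} p 3 fun s => 3 ≤ s.geomDirDim) : WB3 :=
  fun p hp => closedOriginNoNearChain_of_exactGrades (hmono p hp) (hlow p hp) (htop p hp)

/-- **WA + WB give the W-path engine at level 3**: a `ν`-modification of EVERY maximal stratum `ν ≠ Φ^{(3)}` of every reduced
separated `Y` of finite type over a field of characteristic `p`, `dim Y ≤ 3` (curves, surfaces and threefolds alike; the v4
skeleton's `nuMod_three`). [cite: CossartJannsenSaito2020, Def. 6.14, Rem. 6.29] -/
theorem nuMod_three_of_WA_WB (hA : WA3) (hB : WB3) (p : ℕ) (hp : p.Prime) (k : Type) [Field k] [CharP k p] :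
    ∀ (Y : Scheme.{0}) (g : Y ⟶ Spec (.of k)), IsSeparated g → LocallyOfFiniteType g →
      QuasiCompact g → IsReduced Y → topologicalKrullDim Y ≤ ((3 : ℕ) : WithBot ℕ∞) →
      topologicalKrullDim Y ≤ ((3 : ℕ) : WithBot ℕ∞) →
      ∀ ν : ℕ → ℕ, Maximal (· ∈ Scheme.hsValues Y 3) ν → ν ≠ iterPSum 3 Phi → NuMod Y 3 3 ν :=
  fun Y g hsep hft hqc hred hd3 _ ν hν hνΦ => hA p hp (hB p hp) k Y g hsep hft hqc hred hd3 ν hν hνΦ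

/-- **tame_wild v4, W-side (PROVED composition for the lead): the registered statement of `stub_confinedWildNu3`
(v3, verbatim) from the two registrable stubs WA and WB.** [cite: CossartJannsenSaito2020, Rem. 6.29, Def. 6.14] -/
theorem confinedWildNu3_of_WA_WB (hA : WA3) (hB : WB3) :
    ∀ p : ℕ, p.Prime → ∀ (k : Type) [Field k] [CharP k p] (Y : Scheme.{0})
      (g : Y ⟶ Spec (.of k)), IsSeparated g → LocallyOfFiniteType g → QuasiCompact g →
      IsReduced Y → ((3 : ℕ) : WithBot ℕ∞) ≤ topologicalKrullDim Y →
      topologicalKrullDim Y ≤ ((3 : ℕ) : WithBot ℕ∞) →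
      ∀ ν : ℕ → ℕ, Maximal (· ∈ Scheme.hsValues Y 3) ν → ν ≠ iterPSum 3 Phi →
        ¬ (PerfectField k ∧ IsTameValue p ν) →
        ¬ Disjoint (closure ((Scheme.regularLocus Y)ᶜ \ Scheme.hsStratum Y 3 ν))
            (Scheme.hsStratum Y 3 ν) →
        ∀ s : CentreSeq Y, s.AllRegular → s.CentresOver (Scheme.hsStratum Y 3 ν) →
          (∀ x' : s.top, Scheme.hsFun s.top 3 x' ≤ Scheme.hsFun Y 3 (s.comp.base x')) →
          ((fun x' => s.comp.base x') '' Scheme.hsStratum s.top 3 ν).Finite →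
          (∀ y ∈ (fun x' => s.comp.base x') '' Scheme.hsStratum s.top 3 ν,
            IsClosed ({y} : Set Y)) →
          NuMod Y 3 3 ν := by
  intro p hp k _ _ Y g hsep hft hqc hred _ hdim ν hmax hne _ _ _ _ _ _ _ _
  exact hA p hp (hB p hp) k Y g hsep hft hqc hred hdim ν hmax hne

/-! ## §D. REGIMES, POINTEDNESS, and THE ROWS BY NAME (v3.5 re-cut). `Q` is a predicate on the ORIGIN `(N, ν, X, x)`; splits are
`by_cases`. W-low is cut along the printed standing assumption (F1) «`char k(x) = 0` or `char k(x) ≥ dim X/2 + 1`» (CJS p. 103,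
Thm. 10.2; typed `CharHypothesis`): on `{dim ≤ 3}` in characteristic `p > 0` it reads «`3 ≤ p` or `dim X ≤ 2`» (`QCharRegime p`).
W-top is cut by pointedness `X(ν) = {x}` (card C′'s scope). NOT statements of any manuscript. -/

/-- Restriction. [folklore] -/
theorem ClosedOriginNoNearChainAt.toQ {p N : ℕ} {G : MarkedStage.{u} → Prop}
    (h : ClosedOriginNoNearChainAt p N G) (Q : ℕ → (ℕ → ℕ) → ∀ X : Scheme.{u}, X → Prop) :
    ClosedOriginNoNearChainAtQ p N Q G :=
  fun R hF hA ν X _ x hx _ => h R hF hA ν X x hx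

/-- SPLIT: the `Q`-half and the `¬Q`-half give the whole row. [folklore] -/
theorem closedOriginNoNearChainAt_of_split {p N : ℕ} (Q : ℕ → (ℕ → ℕ) → ∀ X : Scheme.{u}, X → Prop)
    {G : MarkedStage.{u} → Prop} (hQ : ClosedOriginNoNearChainAtQ p N Q G)
    (hnQ : ClosedOriginNoNearChainAtQ p N (fun N ν X x => ¬ Q N ν X x) G) :
    ClosedOriginNoNearChainAt p N G := by
  intro R hF hA ν X _ x hx
  by_cases hq : Q N ν X x
  · exact hQ R hF hA ν X x hx hq
  · exact hnQ R hF hA ν X x hx hq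

/-- JOIN β ∧ γ ⇒ W-low-two. [folklore] -/
theorem wlow3Two_of_regimes {p : ℕ} (hβ : Wlow3TwoPerfect.{u} p) (hγ : Wlow3TwoImperfect.{u} p) : Wlow3Two.{u} p := by
  intro e he R hF hA ν X _ x hx hq
  by_cases hk : QPerfectResidueField 3 ν X x
  · exact hβ e he R hF hA ν X x hx ⟨hq, hk⟩
  · exact hγ e he R hF hA ν X x hx ⟨hq, hk⟩

/-- JOIN (F1)-regime ∧ complement ⇒ all exact low grades. [folklore] -/
theorem wlow3_of_char_two {p : ℕ} (hc : Wlow3Char.{u} p) (ht : Wlow3Two.{u} p) :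
    ∀ e ≤ 2, ClosedOriginNoNearChainAt.{u} p 3 fun s => s.geomDirDim = e :=
  fun e he => closedOriginNoNearChainAt_of_split (QCharRegime p) (hc e he) (ht e he)

/-- JOIN pointed ∧ non-pointed ⇒ the top grade. [folklore] -/
theorem wtop3_of_pointed_nonpointed {p : ℕ} (hpt : Wtop3Pointed.{u} p) (hnpt : Wtop3Nonpointed.{u} p) :
    ClosedOriginNoNearChainAt.{u} p 3 fun s => 3 ≤ s.geomDirDim :=
  closedOriginNoNearChainAt_of_split QPointed hpt hnpt

/-- **WB FROM THE FIVE ROWS OF LINE `w_ladder` (PROVED)**: W-mono, W-low-char, W-low-two, W-top-pointed, W-top-nonpointed.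
[folklore] -/
theorem WB3_of_rows (hmono : ∀ p : ℕ, p.Prime → ClosedOriginGeomDirDimNonincrease.{0} p 3)
    (hchar : ∀ p : ℕ, p.Prime → Wlow3Char.{0} p) (htwo : ∀ p : ℕ, p.Prime → Wlow3Two.{0} p)
    (hpt : ∀ p : ℕ, p.Prime → Wtop3Pointed.{0} p) (hnpt : ∀ p : ℕ, p.Prime → Wtop3Nonpointed.{0} p) : WB3 :=
  WB_of_W_exact hmono (fun p hp => wlow3_of_char_two (hchar p hp) (htwo p hp))
    fun p hp => wtop3_of_pointed_nonpointed (hpt p hp) (hnpt p hp)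

/-- `ē ≤ dim` at a marked stage (`ē_x ≤ dim 𝒪_{X,x} ≤ dim X`, CJS Def. 2.21). [cite: CossartJannsenSaito2020, Def. 2.21] -/
theorem geomDirDim_le_dim (s : MarkedStage.{u}) : (s.geomDirDim : WithBot ℕ∞) ≤ topologicalKrullDim s.W := by
  haveI := s.ln
  exact (Scheme.natCast_geomDirDim_le_ringKrullDim_stalk s.pt).trans
    (ringKrullDim_stalk_le_topologicalKrullDim s.W s.pt)

/-- Along a chain from a maximal origin at level `N`, every grade is `≤ N`. [folklore] -/
theorem chain_geomDirDim_le {p N : ℕ} {R : ∀ S : Scheme.{u}, CentreSeq S → Prop} {ν : ℕ → ℕ} {X : Scheme.{u}}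
    [IsLocallyNoetherian X] {x : X} (hX : IsMaximalOrigin p N ν X x) {c : ℕ → MarkedStage.{u}}
    (h0 : Reaches R N ν (MarkedStage.init X x) (c 0)) (hstep : ∀ n, CanonicalNearStep R N ν (c n) (c (n + 1)))
    (n : ℕ) : (c n).geomDirDim ≤ N := by
  have h := (geomDirDim_le_dim (c n)).trans (chain_dim_le h0 hstep (d := N) (by exact hX.dim_le) n)
  exact_mod_cast h

/-- **LINK (PROVED): the pointed W-top row at level 3 follows from the campaign's isolated-origin O2 at grade 3**,
`TertiaryTerminationAt p 3` (s42, informal crux stmt-…-17846 at `e = 3`): a pointed maximal origin is an isolated origin and a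
chain of grade `≥ 3` at level `3` has constant grade `3`. [folklore] -/
theorem wtop3Pointed_of_tertiaryTerminationAt {p : ℕ} (h : TertiaryTerminationAt.{u} p 3) : Wtop3Pointed.{u} p := by
  intro R hRf hRa ν X _ x hX hq
  rintro ⟨c, h0, hstep, hge⟩
  exact h R hRf hRa 3 ν X x ⟨hX.exists_structure, hX.isReduced, hX.dim_le, hX.maximal, hX.isClosed, hq⟩
    ⟨c, h0, hstep, fun n => le_antisymm (chain_geomDirDim_le hX h0 hstep n) (hge n)⟩

/-- **LINK (PROVED): the low rows at level 3 follow from s42's maximal-origin items `NearChainTerminationAt p e`, `e ≤ 2`.**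
[folklore] -/
theorem wlow3_of_nearChainTerminationAt {p : ℕ} (h : ∀ e ≤ 2, NearChainTerminationAt.{u} p e) :
    Wlow3Char.{u} p ∧ Wlow3Two.{u} p :=
  ⟨fun e he => ((nearChainTerminationAt_iff.mp (h e he)) 3).toQ _,
   fun e he => ((nearChainTerminationAt_iff.mp (h e he)) 3).toQ _⟩

/-- For a prime outside the (F1) regime the characteristic is `2` (so `Wlow3Two p` is vacuous for `p ≠ 2`). [folklore] -/
theorem eq_two_of_not_qCharRegime {p : ℕ} (hp : p.Prime) {N : ℕ} {ν : ℕ → ℕ} {X : Scheme.{u}} {x : X}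
    (h : ¬ QCharRegime p N ν X x) : p = 2 ∧ ¬ topologicalKrullDim X ≤ ((2 : ℕ) : WithBot ℕ∞) := by
  have h2 := hp.two_le
  refine ⟨?_, fun hd => h (Or.inr hd)⟩
  by_contra hne
  exact h (Or.inl (by omega))

/-! ## §E. THE SHADOW-LAW INTERFACE (v3.4) — tri-2's STAGEWISE σ-repair of card C′ (`Tri2CardC.lean`: as typed,
`ShadowingLemma3 ↔ (G3LTerminates → target)`), typed GENERICALLY so that the card's remaining obligations become the FIELDS of
one structure and the reduction to the W-top-pointed row is PROVED here. A shadow law for grade `G` from `Q`-origins consists of: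
a type of shadow states `St` with a step relation and a `good` predicate; a shadow map `σ` and a BUDGET `budget : MarkedStage → ℕ`
(card C′: residue-degree / non-linear-near-centre budget K3a/K3b); the LAW: along every canonical near step between in-scope
`G`-stages EITHER the shadow steps and the budget does not grow, OR the budget strictly drops (the «budget-eater» steps); `good`
holds at the shadow of every in-scope `G`-stage (C′: `IsGrade3`, shadow fidelity K3c); and TERMINATION of good shadow plays
(C′: `G3LTerminates`). Instantiation for C′: `St := ShadowState`, `step := ShadowStep`, `good s := IsGrade3 s.A`, `σ` READ OFF
the stage (generating points of Δ(f;y;u) in absorbed coordinates + labels), `Q := QPointed`, `G := (3 ≤ ē)`. NOT a statement of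
any manuscript. -/

/-- **REDUCTION (PROVED): a shadow law gives the `Q`-restricted closed-origin row.** [folklore] -/
theorem closedOriginNoNearChainAtQ_of_shadowLaw {p N : ℕ} {Q : ℕ → (ℕ → ℕ) → ∀ X : Scheme.{u}, X → Prop}
    {G : MarkedStage.{u} → Prop} (L : ShadowLaw.{u} p N Q G) : ClosedOriginNoNearChainAtQ p N Q G := by
  intro R hF hA ν X hX x hx hq
  rintro ⟨c, h0, hstep, hG⟩
  -- every stage of the chain is in scope
  have hscope : ∀ n, InScopeCQ p R N ν Q (c n) := by
    intro n
    induction n with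
    | zero => exact ⟨X, hX, x, hx, hq, h0⟩
    | succ n ih =>
      obtain ⟨X', h', x', hx', hq', hr⟩ := ih
      exact ⟨X', h', x', hx', hq', hr.tail (hstep n)⟩
  -- the budget is non-increasing
  have hb : ∀ n, L.budget (c (n + 1)) ≤ L.budget (c n) := by
    intro n
    rcases L.law R hF hA ν (c n) (c (n + 1)) (hscope n) (hG n) (hG (n + 1)) (hstep n) with h | h
    · exact h.2
    · exact h.le
  have hanti : Antitone fun n => L.budget (c n) := antitone_nat_of_succ_le hb
  -- hence eventually constant, from some stage `n₀` where it attains its infimum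
  set m := sInf (Set.range fun n => L.budget (c n)) with hm
  obtain ⟨n₀, hn₀⟩ : m ∈ Set.range fun n => L.budget (c n) := Nat.sInf_mem ⟨L.budget (c 0), 0, rfl⟩
  have hconst : ∀ k, L.budget (c (n₀ + k)) = m := by
    intro k
    apply le_antisymm
    · rw [← hn₀]; exact hanti (Nat.le_add_right n₀ k)
    · exact Nat.sInf_le ⟨n₀ + k, rfl⟩
  -- so from `n₀` on every step is a shadow step
  have hshadow : ∀ k, L.step (L.σ (c (n₀ + k))) (L.σ (c (n₀ + k + 1))) := by
    intro k
    rcases L.law R hF hA ν (c (n₀ + k)) (c (n₀ + k + 1)) (hscope _) (hG _) (hG _) (hstep _) with h | h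
    · exact h.1
    · exfalso
      have h1 := hconst k
      have h2 := hconst (k + 1)
      rw [← Nat.add_assoc] at h2
      omega
  -- contradiction with termination of good shadow plays
  exact L.terminates (fun k => L.σ (c (n₀ + k))) (L.good_of_scope R hF hA ν _ (hscope n₀) (hG n₀)) hshadow

/-- The W-top-pointed row from a shadow law in every prime characteristic (card C′'s programme, typed). [folklore] -/
theorem Wtop3_pointed_of_shadowLaw
    (L : ∀ p : ℕ, p.Prime → ShadowLaw.{0} p 3 QPointed fun s => 3 ≤ s.geomDirDim) :
    ∀ p : ℕ, p.Prime → ClosedOriginNoNearChainAtQ.{0} p 3 QPointed fun s => 3 ≤ s.geomDirDim :=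
  fun p hp => closedOriginNoNearChainAtQ_of_shadowLaw (L p hp)

/-- The pointed half of W-top from the σ-row. [folklore] -/
theorem Wtop3_pointed_of_stub
    (h : ∀ p : ℕ, p.Prime → Nonempty (ShadowLaw.{0} p 3 QPointed fun s => 3 ≤ s.geomDirDim)) :
    ∀ p : ℕ, p.Prime → ClosedOriginNoNearChainAtQ.{0} p 3 QPointed fun s => 3 ≤ s.geomDirDim :=
  fun p hp => closedOriginNoNearChainAtQ_of_shadowLaw (h p hp).some

/-- The named row from a shadow law. [folklore] -/
theorem wtop3Pointed_of_shadowLaw {p : ℕ} (L : ShadowLaw.{u} p 3 QPointed fun s => 3 ≤ s.geomDirDim) : Wtop3Pointed.{u} p :=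
  closedOriginNoNearChainAtQ_of_shadowLaw L

/-! ## §F. THE F-KEY BRIDGES (stub-2's SIGNATURE-PROPOSAL 02:28:02Z, ADOPTED WITH AMENDMENTS by CHAIN v3.6): low-grade canonical near
chains ↦ the carriers of res-type-053's typed key theorems (`KeyTheorems.lean`, p484877; `KeyTheoremsIsolated.lean`, p486755).
Amendments: (a) grade EXACTLY `2` for the unit bridge (grade-`1` tails go to Cor. 6.37 through `Bridge3Seq`, grade-`0` tails have no
near point); (b) origin in the (F1) regime `QCharRegime p` (the complement is row W-low-two, not a bridge); (c) the prover may pass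
to any tail of the chain and chooses the modelling (flat base change to `Spec 𝒪_{X_n,x_n}`, tree `BlowupsFlatBaseChange`; compression
of idle steps by `WFair`) — the interface hides it. Obligations inside (CHAIN v3.5 §0d): B-req-1 quasi-isolation at unit starts (G1
`interleavedCurveInvariance3`), B-req-2 unit recognition (Def. 6.38 (ii)–(v) along the run: CJS Lemma 6.23 / Thm. 6.17-type content),
B-req-3 contiguity / compression, B-req-4 `e = ē = 2` at unit ends (F3). Citation of record for the consumer: `KeyTheorem640_char`
(print-faithful, res-lit-6 02:43:16Z; fallback `KeyTheorem640_char_isolated` via `KeyTheorem640_char_isolated_of`). NOT statements of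
any manuscript. -/

section Bridge

open Literature.AlgebraicGeometry.CossartJannsenSaito2020

/-- **Grade 2 of row W-low-char from F-key Thm. 6.40 and the unit bridge (PROVED reduction).** [cite: CossartJannsenSaito2020, Thm. 6.40] -/
theorem wlow3Char_e2_of_bridge {p : ℕ} (hK : KeyTheorem640_char.{0}) (hB : Bridge3 p) :
    ClosedOriginNoNearChainAtQ.{0} p 3 (QCharRegime p) fun s => s.geomDirDim = 2 := by
  intro R hRf hRa ν X _ x hx hq
  rintro ⟨c, hreach, hstep, hgrade⟩
  obtain ⟨T, len, pt, hset, hchar, hchain, hiso⟩ := hB R hRf hRa ν X x hx hq c hreach hstep hgrade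
  exact hK T 3 len pt hset hchar hchain hiso

/-- **Grade 1 of row W-low-char from F-key Cor. 6.37 and the point-sequence bridge (PROVED reduction).**
[cite: CossartJannsenSaito2020, Cor. 6.37] -/
theorem wlow3Char_e1_of_bridgeSeq {p : ℕ} (hC : Corollary637_char.{0}) (hB : Bridge3Seq p) :
    ClosedOriginNoNearChainAtQ.{0} p 3 (QCharRegime p) fun s => s.geomDirDim = 1 := by
  intro R hRf hRa ν X _ x hx hq
  rintro ⟨c, hreach, hstep, hgrade⟩
  obtain ⟨T, x₀, hset, hchar, hF, hiso, he⟩ := hB R hRf hRa ν X x hx hq c hreach hstep hgrade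
  exact lt_irrefl _ (hC T 3 x₀ ⊤ hset hchar hF hiso he).1

/-- **Row W-low-char assembled from its three exact grades (PROVED join)**: grade `0` (helper row `Wlow3Char_e0`), grade `1`
(Cor. 6.37 + `Bridge3Seq`), grade `2` (Thm. 6.40 + `Bridge3`). [folklore] -/
theorem wlow3Char_of_grades {p : ℕ}
    (h0 : ClosedOriginNoNearChainAtQ.{0} p 3 (QCharRegime p) fun s => s.geomDirDim = 0)
    (h1 : ClosedOriginNoNearChainAtQ.{0} p 3 (QCharRegime p) fun s => s.geomDirDim = 1)
    (h2 : ClosedOriginNoNearChainAtQ.{0} p 3 (QCharRegime p) fun s => s.geomDirDim = 2) : Wlow3Char.{0} p := by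
  intro e he
  interval_cases e
  · exact h0
  · exact h1
  · exact h2

end Bridge


end Summit.ResolutionOfSingularities.ResolutionOfSingularities.Theorems.SigmaMaxModificationsCorridor3.Helpers

end
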